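import Mathlib
import HarnessLib
import HarnessLib.Audit
import Summits.HubbardSuperconductivity.Statement

/-!
Route: ShibaRP

CLOSED (superseded) 2026-08-15T12:53:03Z by planner-HubbardSuperconductivity-route-HubbardSuperconductivity-ShibaRP-0 — reason: superseded:route-HubbardSuperconductivity-JosephsonMirror — superseded by route-HubbardSuperconductivity-JosephsonMirror — note: route-repair census (planner, 2026-08-15): CLOSED as superseded by route-HubbardSuperconductivity-JosephsonMirror. WHY: (1) mechanism gap in the rank-2 crux ShibarpReflectionPositivity — after the Shiba map the dual Hamiltonian W·H_U·W* = H_{-U} + U·N_up is still n.n. hopping + on-site terms; fermio. The file is kept as the record of this route; refuted decls are indexed as negative knowledge (`ledger negatives`).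

# Route ShibaRP — HubbardSuperconductivity (planner-HubbardSuperconductivity-Survey-0, 2026-08-13;
brief=widen)

## Thesis X (it suffices to show)
Dictionary (exact, finite volume, EVEN L only): the Shiba partial particle–hole unitary W on the ↓
orbitals,
c_{x↓} ↦ ε_x c†_{x↓} with ε = torusStagger, conjugates `hubbardTorus 2 L 1 U` to `hubbardTorus 2 L 1
(-U) + U·N_↑`,
maps the sector (N_L, S^z=0) onto the HALF-FILLED magnetised sector (L², (N_L - L²)/2), and maps the
d-wave singlet
pair field Δ_d = Σ_x P_x to a staggered d-wave bond spin-flip operator B_d = Σ_x B_x [Shiba1972,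
Tasaki1998 §5].
X := ∃ U > 0, δ ∈ (0,1), c > 0 such that
 (a) [dual side, even L] every normalised ground state φ_L of the attractive half-filled torus
`hubbardTorus 2 L 1 (-U)`
     in the sector (L², (N_L - L²)/2) has liminf_{L even} L⁻⁴ Σ_{x,y} Re⟨φ_L, B_x† B_y φ_L⟩ ≥ c, and
 (b) [odd L, original side] every (N_L,0)-sector GS of `hubbardTorus 2 L 1 U` has L⁻⁴ Re⟨Δ_d†Δ_d⟩ ≥
c for odd L ≥ L₀.
Assembly X → S: W is unitary and sector-preserving as stated, so (a) is literally the even-L half of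
`HasTorusLRO (pairFieldCorr dWaveFormFactor ψ)`; with (b), liminf over all L ≥ c > 0.
Lean: informal today — needs_definition `shibaTransform`, `dBondSpinFlip` (requests filed); olean
outage noted in STATUS.

## Why this line (widen: reflection positivity + Fourier-space infrared bounds, transported by an
exact duality)
Ground-state LRO for a continuous symmetry in d = 2 HAS been proved rigorously in exactly one way:
reflection positivity
⇒ Gaussian domination ⇒ infrared bound, closed at T = 0 by the Kennedy–Lieb–Shastry sum-rule
argument (XY model, all
S, d ≥ 2 [KLS1988PRL]; Heisenberg S ≥ 1 [NevesPerez1986]; framework [DysonLiebSimon1978]). Itinerant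
fermions are not RP
in general, but the HALF-FILLED band is: Lieb's flux-phase proof [Lieb1994] and the Majorana RP
criterion
[JaffePedrocchi2015] give RP for real n.n. hopping + on-site terms under bond-bisecting reflections
combined with an
antiunitary particle–hole twist. The Shiba map moves the doped repulsive problem to half filling
(doping ↦ magnetisation,
an ON-SITE Zeeman-type constraint compatible with RP), so the KLS machine can at least be pointed at
S. Whether the
inequality closes is a finite, certifiable computation (crux 3).

## Ranked cruxes
2. RP claim: for even L and all U, h ∈ ℝ, `hubbardTorusWith 2 L 1 (-U) (-U/2) - h·(2·spinZ)` is
reflection positive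
   (Jaffe–Pedrocchi sense) for every bond-bisecting line reflection of (ℤ/Lℤ)², and Gaussian
domination holds for the
   Fourier modes B_d(k), k ≠ (π,π), of the dual bond operator. needs_definition IsFermionRP. Most
informative: a clean
   NO here closes the route; a YES is a publishable Literature theorem reusable by AF/CDW
statements.
3. KLS closure (certified computation): ∃ U, h and even-L-uniform constants such that sum rule −
Σ_{k≠Q} infrared
   bounds (Gaussian-domination constant × double commutator ⟨[[B_d(k)†,H],B_d(k)]⟩ bound)^{1/2} > 0.
Informal.
4. Shiba identities (dictionary; elementary, provable once defined): W unitary; W H_U W* = H_{-U} +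
U N_↑;
   W(szSector N 0) = szSector L² ((N-L²)/2); W Δ_d W* = B_d. needs_definition shibaTransform.
5. Field ↔ sector: for the (U,h) of crux 3, field ground states concentrate on the sector S^z =
(N_L-L²)/2 (strictly
   monotone magnetisation at h), so EVERY sector GS inherits the bound. Informal.
(b) of X (odd L) is carried as part of the thesis item, not decomposed: RP needs bipartite tori.

## Kill criteria
- Crux 2 refuted (RP fails for the field/half-filled Hubbard torus under bond reflections) → close
route.
- Crux 3 certified to fail on a (U,h) grid with monotonicity control (weak |U|: order parameter
~e^{-C/U²}, hopeless;
  so the window is |U| ≳ 4) → close.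
- Odd-L clause (b) refuted → report Statement wrinkle (liminf over all L) to operator; route
survives only for an
  even-L variant of S.

## Deliberately NOT decomposed yet
The double-commutator algebra for B_d(k), the explicit Gaussian-domination constant, ensemble
equivalence details,
and the map back from (U<0, half filling, field) parameters to (U>0, δ).

Rationale: widen: Shiba partial particle-hole duality (even L) to the half-filled attractive model in a field +
fermionic reflection positivity (Lieb1994, JaffePedrocchi2015) + KLS1988 T=0 infrared bounds; rank-2
crux = RP claim

History (route lifecycle, newest last):
- 2026-08-15T12:53:03Z · CLOSED superseded — superseded:route-HubbardSuperconductivity-JosephsonMirror (planner-HubbardSuperconductivity-route-HubbardSuperconductiv)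

sub-problem: HubbardSuperconductivity · status: closed(superseded) · opened planner-HubbardSuperconductivity-Survey-0 2026-08-13T06:04:33Z · rev 0 · ledger route-HubbardSuperconductivity-ShibaRP
GENERATED by the gate from the ledger (D-0016/17). Provers cite these decls: `theorem foo : Summit.HubbardSuperconductivity.HubbardSuperconductivity.Theses.ShibaRP.<Decl> := …` in Summits/HubbardSuperconductivity/HubbardSuperconductivity/Theorems/<Name>.lean.
-/

namespace Summit.HubbardSuperconductivity.HubbardSuperconductivity.Theses.ShibaRP

open scoped BigOperators Topology Manifold Classical MeasureTheory ProbabilityTheory Matrix InnerProductSpace ComplexConjugate ContinuousMap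
open Filter Set Function TopologicalSpace MeasureTheory

attribute [summit_statement] _root_.HubbardSuperconductivity

open Literature.Hubbard

-- item stmt-HubbardSuperconductivity-0161 · crux · rank 0 · closed · moot by None · by planner — informal only, no Lean statement yet:
--   X := ∃ U>0, δ∈(0,1), c>0: (a) for every even L ≥ L₀ and every normalised ground state φ of
--   hubbardTorus 2 L 1 (−U) in szSector L² ((N_L − L²)/2), N_L = 2⌊(1−δ)L²/2⌋, one has L⁻⁴ Σ_{x,y} Re⟨φ,
--   B_x† B_y φ⟩ ≥ c where B_x := W (localPair dWaveFormFactor L x) W⁻¹ is the Shiba image (staggered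
--   d-wave bond spin-flip operator) under the partial particle–hole unitary W: c_{x↓} ↦ torusStagger x ·
--   c†_{x↓}, c_{x↑} ↦ c_{x↑}; (b) for every odd L ≥ L₀ and every normalised (N_L,0)-sector GS ψ of
--   hubbardTorus 2 L 1 U, L⁻⁴ Re⟨ψ, Δ_d†Δ_d ψ⟩ ≥ c. Lean signature awaits def requests shibaTransform,
--   dBondSpinFlip. |

-- item stmt-HubbardSuperconductivity-0163 · crux · rank 2 · closed · moot by None · by planner — informal only, no Lean statement yet:
--   For even L and all U, h ∈ ℝ, H = hubbardTorusWith 2 L 1 (−U) (−U/2) − h·(2·spinZ) on Fock((ℤ/Lℤ)²):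
--   for every reflection θ of the torus in a line bisecting bonds there is an antiunitary
--   particle–hole-twisted reflection Θ of the CAR algebra with H = A + Θ(A) − Σ_i C_i Θ(C_i) (A, C_i
--   localized in one half), so that the ground-state / Gibbs functional satisfies RP ⟨F Θ(F)⟩ ≥ 0, and
--   consequently the Gaussian-domination / infrared bound (B_d(k), B_d(k))_Duhamel ≤ (2 E(k))⁻¹ holds
--   for k ≠ Q = (π,π), E(k) = Σ_i (1 − cos k_i), for the Fourier modes of the Shiba-dual d-wave bond
--   spin-flip operator. Lie

-- item stmt-HubbardSuperconductivity-0164 · support · rank 3 · closed · moot by None · by planner — informal only, no Lean statement yet: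
--   Assume crux #2. KLS 1988 scheme at T = 0: (i) sum rule L⁻² Σ_k ⟨B_d(k)† B_d(k) + B_d(k) B_d(k)†⟩_GS
--   = explicit local quantity ρ_loc(U,h) bounded BELOW via the GS energy (variational upper bound on
--   e_GS by Slater/Gutzwiller trial states with exactly computable energies); (ii) for k ≠ Q,
--   ⟨B_d(k)†B_d(k) + h.c.⟩ ≤ (infrared Duhamel bound (2E(k))⁻¹ · double commutator ⟨[[B_d(k)†, H],
--   B_d(k)]⟩)^{1/2} with the double commutator bounded ABOVE by an explicit c(U,h)·(local energy);
--   CLAIM: ∃ U > 0, h and ε > 0 with ρ_loc − L⁻² Σ_{k≠Q} (ii) ≥ ε for all even L ≥ L₀, hence staggered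
--   LRO ≥ ε at k = Q for eve

/-- item stmt-HubbardSuperconductivity-0165 · support · rank 4 · closed · moot by None · by planner
For even L let W := Π_x (unitary implementing c_{x↓} ↦ ε_x c†_{x↓}, c_{x↑} ↦ c_{x↑}), ε =
torusStagger (bipartite sign needs Even L: torusStagger_eq_neg_of_adj). CLAIMS: (i) W ∈
unitaryGroup; (ii) W · hubbardTorus 2 L t U · W⁻¹ = hubbardTorus 2 L t (−U) + U · Σ_x numberOp x 0;
(iii) W maps szSector N M onto szSector (N/2 + M + L² − (N/2 − M)) ((N − L²)/2) — for M = 0: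
szSector L² ((N−L²)/2); in particular sector ground states correspond (energies shift by the
constant U·N/2 on the sector); (iv) W · localPair g L x · W⁻¹ = dBondSpinFlip g L x for every form
factor g. Compare FermionOperators.particleHole (full p-h) and
HubbardModel.hamiltonian_particleHole_bipartite. || needs_definition:
Literature.QLattice.shibaTransform, Literature.QLattice.dBondSpinFlip. || Sources: Shiba1972,
Tasaki1998, LiebPRL1989. -/
@[route_item "route-HubbardSuperconductivity-ShibaRP"]
def ShibarpShibaIdentities : Prop :=
  ∀ (L : ℕ) [NeZero L], Even L → ∀ (t U : ℝ) (W : Matrix (Finset (Literature.MathematicalPhysics.QuantumLattice.Orb (Literature.MathematicalPhysics.QuantumLattice.FermionTorus 2 L))) (Finset (Literature.MathematicalPhysics.QuantumLattice.Orb (Literature.MathematicalPhysics.QuantumLattice.FermionTorus 2 L))) ℂ), W ∈ Matrix.unitaryGroup (Finset (Literature.MathematicalPhysics.QuantumLattice.Orb (Literature.MathematicalPhysics.QuantumLattice.FermionTorus 2 L))) ℂ → (∀ x : Literature.MathematicalPhysics.QuantumLattice.FermionTorus 2 L, W * Literature.MathematicalPhysics.QuantumLattice.annihilation (Literature.MathematicalPhysics.QuantumLattice.orb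 x 1) * Wᴴ = ((Literature.MathematicalPhysics.QuantumLattice.torusStagger x : ℤ) : ℂ) • Literature.MathematicalPhysics.QuantumLattice.creation (Literature.MathematicalPhysics.QuantumLattice.orb x 1)) → (∀ x : Literature.MathematicalPhysics.QuantumLattice.FermionTorus 2 L, W * Literature.MathematicalPhysics.QuantumLattice.annihilation (Literature.MathematicalPhysics.QuantumLattice.orb x 0) * Wᴴ = Literature.MathematicalPhysics.QuantumLattice.annihilation (Literature.MathematicalPhysics.QuantumLattice.orb x 0)) → W * Literature.MathematicalPhysics.QuantumLattice.hubbardTorus 2 L t U * Wᴴ = Literature.MathematicalPhysics.QuantumLattice.hubbardTorus 2 L t (-U) + (U : ℂ) • ∑ x : Literature.MathematicalPhysics.QuantumLattice.FermionTorus 2 L, Literature.MathematicalPhysics.QuantumLattice.numberOp x 0 ∧ ∀ (N : ℕ) (ψ : Literature.MathematicalPhysics.QuantumLattice.Fock (Literature.MathematicalPhysics.QuantumLattice.Orb (Literature.MathematicalPhysics.QuantumLattice.FermionTorus 2 L))), ψ ∈ Literature.MathematicalPhysics.QuantumLattice.szSector N 0 → W.mulVec ψ ∈ Literature.MathematicalPhysics.QuantumLattice.szSector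 (L ^ 2) (((N : ℝ) - L ^ 2) / 2)

-- item stmt-HubbardSuperconductivity-0166 · support · rank 5 · closed · moot by None · by planner — informal only, no Lean statement yet:
--   For the (U, h-window) where crux #3 closes: for all even L ≥ L₀ there is h_L ∈ [h₋, h₊] such that
--   minEnergy of hubbardTorusWith 2 L 1 (−U) (−U/2) − h_L·2·spinZ over all of Fock space is attained
--   EXACTLY on szSector L² ((N_L − L²)/2) ⊕ (nothing else contributing to B_d-LRO), so that the KLS
--   bound for field ground states transfers to EVERY sector ground state. Amounts to strict monotonicity
--   / no macroscopic jump of the T=0 magnetisation curve of the attractive half-filled model at m = δ/2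
--   (phase separation would break it). || Sources: Tasaki1998, LiebPRL1989.

-- item stmt-HubbardSuperconductivity-0162 · assembly · rank 1 · closed · moot by None · by planner — informal only, no Lean statement yet:
--   W is unitary, W (hubbardTorus 2 L 1 U) W⁻¹ = hubbardTorus 2 L 1 (−U) + U·N_↑, W (szSector N_L 0) =
--   szSector L² ((N_L−L²)/2), and W Δ_d W⁻¹ = B_d (crux #4, even L); hence (a) equals the even-L half of
--   the liminf in HasTorusLRO (pairFieldCorr dWaveFormFactor ψ) for every HYP-sequence ψ; with (b) the
--   liminf over all L is ≥ c > 0; the IsNParticle/normalisation clause is WeakCouplingBCS #5. ||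
--   needs_definition: Literature.QLattice.shibaTransform. || Sources: Shiba1972, Tasaki1998.

end Summit.HubbardSuperconductivity.HubbardSuperconductivity.Theses.ShibaRP
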